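import Summits.BirchSwinnertonDyer.BirchSwinnertonDyer.Theorems.EisensteinDepletionAtTwoFamily81517IsogenySelmerBoundB
import Summits.BirchSwinnertonDyer.BirchSwinnertonDyer.Theorems.EisensteinDepletionAtTwoFamily81517IsogenySelmerBoundC

/-!
**PART D (§§3–5): the Selmer inclusions, `dim₂ S ≤ 2`, `dim₂ S' ≤ 3`, `rank ≤ 3` on the odd family, sharpness at rank `3`, transport to `Family81517.curve j n`.** (one kernel unit `Family81517IsogenySelmerBound{A,B,C,D}`, checked as a single file rc 0; split for the 400-line lint.)

# Route EisensteinDepletionAtTwo — door `T-r3₂`: the WHOLE odd family has `rank ≤ 3`, and `rank = 3 ⇒ corank Sel_{2^∞} = 3`,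
UNCONDITIONALLY (parametric complete `2`-isogeny descent in the kernel; planner p2 GEN 39, landed by lead star-p1 GEN 14)

For every admissible member `(j, n)` of the door family (`m = 8j + 3`, `q = m + 64 n²`, `r = m + 289 n²` prime,
`60 ∣ n`) put `E = E_{−17q, 16qr} : y² = x(x − q)(x − 16 r)·…` (the tree's `⟨0, −17q, 0, 16qr, 0⟩`, carried to
`Family81517.curve j n` by `(u,r,s,t) = (2,0,1,0)`, `variableChange_family81517`) and `E' = E_{34q, 225mq}`.
Because `60 ∣ n` gives `q ≡ r ≡ m (mod 3600)`, every local computation at `2`, `3`, `5` is a function of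
`m mod 16 ∈ {3, 11}`, `m mod 9`, `m mod 25` only, and is settled by `decide` over `ZMod 16 / 9 / 25` UNIFORMLY IN THE MEMBER
(kit census j322002/j322023: the kill table is well defined on residues). Results (all sorry-free, standard axioms):

* `selmerGroup_subset` : `S^{(φ̂)}(E'/ℚ) = S(−17q, 16qr) ⊆ {1, q, r, qr}` (negatives die over `ℝ`, the even classes
  `2·{1,q,r,qr}` die `2`-adically: no solutions modulo `16`), so `dim₂ S^{(φ̂)} ≤ 2`;
* `selmerGroup'_subset_three` (`m ≡ 2 (mod 3)`): `S^{(φ)}(E/ℚ) = S(34q, 225mq) ⊆ {1, mq, −q, −m, 5, 5mq, −5q, −5m}`;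
  `selmerGroup'_subset_five` (`m ≡ ±2 (mod 5)`): `S(34q, 225mq) ⊆ {1, mq, −q, −m, −3, −3mq, 3q, 3m}` — the classes with
  `3 ∥ d` die modulo `9` when `m ≡ 2 (3)`, those with `5 ∥ d` die modulo `25` when `m ≡ ±2 (5)`, and the classes
  `d ≡ 3 (mod 4)` die modulo `16`; so `dim₂ S^{(φ)} ≤ 3` whenever `m ≡ 2 (3)` or `m ≡ ±2 (5)`;
* the root-number-odd half `OddSign` is exactly «`q ≡ 2 (3)` and `q ≡ ±1 (5)`» or «`q ≡ 1 (3)` and `q ≡ ±2 (5)`», and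
  `q ≡ m (mod 15)`, so on the odd half `dim₂ S + dim₂ S' ≤ 5` and **`rank E(ℚ) ≤ 3`**
  (`twoIsogeny_mordellWeilRank_add_two_le_holds`; with the tree's `two_le_mordellWeilRank_family81517`: `rank ∈ {2, 3}`);
* if `rank E(ℚ) = 3` the descent is sharp: `Ш(E/ℚ)[2] = 0`, `corank_{ℤ₂} Ш[2^∞] = 0`, **`corank Sel_{2^∞}(E) = 3`**, and
  `(dim₂ S, dim₂ S') = (2, 3)` exactly (`forall_mem_sha_two_smul_eq_zero_of_selmerRank_add_le`,
  `selmerCorank_eq_mordellWeilRank_add_holds`), transported to `Family81517.curve j n` (`selmerCorank_eq_of_variableChange`).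

Door reading (`SelmerCorankEqOrderEqThreeOnOddFamily`, conjunct (ii) first half «`corank Sel_{2^∞} = 3`»): on the odd
family it is EQUIVALENT to «`rank = 3`, or `rank = 2` with `corank Ш[2^∞] = 1`»; the fifteen rank-`3` members of the kit
census (j321923) are exactly the sharp ones. Nothing here proves BSD, the analytic conjunct, or moves S0; Barrier B1 honest.
-/

set_option linter.dupNamespace false
set_option linter.unusedTactic false
set_option autoImplicit false

namespace Summit.BirchSwinnertonDyer.BirchSwinnertonDyer.Theorems.Family81517IsogenySelmerBound

open Literature.NumberTheory.EllipticCurves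
open Summit.BirchSwinnertonDyer.Rank2
open _root_.WeierstrassCurve

variable {m q r : ℕ} {n : ℤ}

/-! ### 3. `S ⊆ {1, q, r, qr}`; `S' ⊆` eight classes -/

/-- An eight-element `Finset` literal has at most eight elements. [folklore] -/
theorem card_le_eight {α : Type*} [DecidableEq α] {a b c d e f g h : α} :
    ({a, b, c, d, e, f, g, h} : Finset α).card ≤ 8 :=
  (Finset.card_insert_le _ _).trans (Nat.succ_le_succ ((Finset.card_insert_le _ _).trans (Nat.succ_le_succ Finset.card_le_six)))

/-- `2^k ≤ 2^l ⇒ k ≤ l`. [folklore] -/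
theorem le_of_two_pow_le {k l : ℕ} (h : 2 ^ k ≤ 2 ^ l) : k ≤ l :=
  (Nat.pow_le_pow_iff_right (by norm_num)).mp h

/-- **`S^{(φ̂)}(E'/ℚ) = S(−17q, 16qr) ⊆ {1, q, r, qr}`** for every admissible member: negatives die over `ℝ`
(`a = −17q ≤ 0`), the squarefree divisors of `16qr` are `± {1,2}·{1,q}·{1,r}`, and the even ones die modulo `16`.
[cite: SilvermanAEC2009, Prop. X.4.9 and Example X.4.10] -/
theorem selmerGroup_subset (hq : q.Prime) (hr : r.Prime) (hn : 60 ∣ n) (hq_eq : (q : ℤ) = m + 64 * n ^ 2) (hr_eq : (r : ℤ) = m + 289 * n ^ 2) (hm8 : m % 8 = 3) :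
    twoIsogenySelmerGroup (-17 * q) (16 * q * r) ⊆ ({1, (q : ℤ), (r : ℤ), (q : ℤ) * r} : Finset ℤ) := by
  intro d hd
  have hB := b_ne_zero hq hr
  obtain ⟨hsq, hdvd, hloc⟩ := (mem_twoIsogenySelmerGroup_iff (a := -17 * (q : ℤ)) hB).mp hd
  have hq0 : (0 : ℤ) < q := by exact_mod_cast hq.pos
  have hr0 : (0 : ℤ) < r := by exact_mod_cast hr.pos
  have hdpos : 0 < d := by
    rcases lt_trichotomy d 0 with hneg | h0 | hpos
    · exfalso
      have hquot : (16 * q * r : ℤ) / d < 0 := by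
        obtain ⟨k, hk⟩ := hdvd
        rw [hk, Int.mul_ediv_cancel_left _ hneg.ne]
        nlinarith
      exact not_isSoluble_real_twoIsogenyQuartic_of_neg hneg hquot (by nlinarith) hloc.1
    · exact absurd h0 hsq.ne_zero
    · exact hpos
  have h1 : d ∣ 2 * q * r :=
    (hsq.dvd_pow_iff_dvd (by norm_num : (4 : ℕ) ≠ 0)).mp (dvd_trans hdvd ⟨(q : ℤ) ^ 3 * r ^ 3, by ring⟩)
  have h2 : d.natAbs ∣ 2 * (q * r) := by
    have h := Int.natAbs_dvd_natAbs.mpr h1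
    have e : (2 * (q * r) : ℕ) = (2 * q * r : ℤ).natAbs := by
      zify; rw [abs_of_nonneg (by positivity)]; ring
    rwa [e]
  obtain ⟨y, z, hy, hz, hyz⟩ := Nat.dvd_mul.mp h2
  obtain ⟨y₁, z₁, hy₁, hz₁, rfl⟩ := Nat.dvd_mul.mp hz
  rw [Nat.dvd_prime Nat.prime_two] at hy
  rw [Nat.dvd_prime hq] at hy₁
  rw [Nat.dvd_prime hr] at hz₁
  have hd' : d = ((y * (y₁ * z₁) : ℕ) : ℤ) := by rw [hyz]; exact (Int.natAbs_of_nonneg hdpos.le).symm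
  rcases hy with rfl | rfl <;> rcases hy₁ with rfl | rfl <;> rcases hz₁ with rfl | rfl <;>
    push_cast at hd' <;> subst hd'
  all_goals first
    | (simp; done)
    | (refine absurd hd (notMem_of_eq (nS_2 (m := m) hq hr hn hq_eq hr_eq hm8) ?_); ring1) | (refine absurd hd (notMem_of_eq (nS_2q (m := m) hq hr hn hq_eq hr_eq hm8) ?_); ring1) | (refine absurd hd (notMem_of_eq (nS_2r (m := m) hq hr hn hq_eq hr_eq hm8) ?_); ring1) | (refine absurd hd (notMem_of_eq (nS_2qr (m := m) hq hr hn hq_eq hr_eq hm8) ?_); ring1)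

/-- **`S^{(φ)}(E/ℚ) = S(34q, 225mq) ⊆ {1, mq, −q, −m, 5, 5mq, −5q, −5m}` when `m ≡ 2 (mod 3)`**: the squarefree
divisors of `225mq` are `± {1,3}·{1,5}·{1,m}·{1,q}`; those with `3 ∥ d` die modulo `9`, those `≡ 3 (mod 4)` modulo `16`.
[cite: SilvermanAEC2009, Prop. X.4.9 and Example X.4.10] -/
theorem selmerGroup'_subset_three (hm : m.Prime) (hq : q.Prime) (hn : 60 ∣ n) (hq_eq : (q : ℤ) = m + 64 * n ^ 2) (hm8 : m % 8 = 3) (h3 : m % 3 = 2) :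
    twoIsogenySelmerGroup (34 * q) (225 * m * q) ⊆
      ({1, (m : ℤ) * q, -(q : ℤ), -(m : ℤ), 5, 5 * ((m : ℤ) * q), -(5 * (q : ℤ)), -(5 * (m : ℤ))} : Finset ℤ) := by
  intro d hd
  obtain ⟨hsq, hdvd, -⟩ := (mem_twoIsogenySelmerGroup_iff (a := 34 * (q : ℤ)) (b'_ne_zero hm hq)).mp hd
  have h1 : d ∣ 15 * m * q :=
    (hsq.dvd_pow_iff_dvd (by norm_num : (2 : ℕ) ≠ 0)).mp (dvd_trans hdvd ⟨(m : ℤ) * q, by ring⟩)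
  have h2 : d.natAbs ∣ 3 * (5 * (m * q)) := by
    have h := Int.natAbs_dvd_natAbs.mpr h1
    have e : (3 * (5 * (m * q)) : ℕ) = (15 * m * q : ℤ).natAbs := by
      zify; rw [abs_of_nonneg (by positivity)]; ring
    rwa [e]
  obtain ⟨y, z, hy, hz, hyz⟩ := Nat.dvd_mul.mp h2
  obtain ⟨y₁, z₁, hy₁, hz₁, rfl⟩ := Nat.dvd_mul.mp hz
  obtain ⟨y₂, z₂, hy₂, hz₂, rfl⟩ := Nat.dvd_mul.mp hz₁
  rw [Nat.dvd_prime Nat.prime_three] at hy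
  rw [Nat.dvd_prime Nat.prime_five] at hy₁
  rw [Nat.dvd_prime hm] at hy₂
  rw [Nat.dvd_prime hq] at hz₂
  rcases Int.natAbs_eq d with hd' | hd' <;> rw [← hyz] at hd' <;>
    rcases hy with rfl | rfl <;> rcases hy₁ with rfl | rfl <;> rcases hy₂ with rfl | rfl <;> rcases hz₂ with rfl | rfl <;>
    push_cast at hd' <;> subst hd'
  all_goals first
    | (simp; done)
    | (refine absurd hd (notMem_of_eq (nSp16_p1_m hm hq hn hq_eq hm8) ?_); ring1) | (refine absurd hd (notMem_of_eq (nSp16_p1_q hm hq hn hq_eq hm8) ?_); ring1) | (refine absurd hd (notMem_of_eq (nSp16_p5_m hm hq hn hq_eq hm8) ?_); ring1) | (refine absurd hd (notMem_of_eq (nSp16_p5_q hm hq hn hq_eq hm8) ?_); ring1) | (refine absurd hd (notMem_of_eq (nSp16_n3_m hm hq hn hq_eq hm8) ?_); ring1) | (refine absurd hd (notMem_of_eq (nSp16_n3_q hm hq hn hq_eq hm8) ?_); ring1) | (refine absurd hd (notMem_of_eq (nSp16_n1_1 hm hq hn hq_eq hm8) ?_); ring1) | (refine absurd hd (notMem_of_eq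 (nSp16_n1_mq hm hq hn hq_eq hm8) ?_); ring1) | (refine absurd hd (notMem_of_eq (nSp16_n5_1 hm hq hn hq_eq hm8) ?_); ring1) | (refine absurd hd (notMem_of_eq (nSp16_n5_mq hm hq hn hq_eq hm8) ?_); ring1) | (refine absurd hd (notMem_of_eq (nSp16_p3_1 hm hq hn hq_eq hm8) ?_); ring1) | (refine absurd hd (notMem_of_eq (nSp16_p3_mq hm hq hn hq_eq hm8) ?_); ring1) | (refine absurd hd (notMem_of_eq (nSp9_p3_1 hm hq hn hq_eq h3) ?_); ring1) | (refine absurd hd (notMem_of_eq (nSp9_p3_m hm hq hn hq_eq h3) ?_); ring1) | (refine absurd hd (notMem_of_eq (nSp9_p3_q hm hq hn hq_eq h3) ?_); ring1) | (refine absurd hd (notMem_of_eq (nSp9_p3_mq hm hq hn hq_eq h3) ?_); ring1) | (refine absurd hd (notMem_of_eq (nSp9_n3_1 hm hq hn hq_eq h3) ?_); ring1) | (refine absurd hd (notMem_of_eq (nSp9_n3_m hm hq hn hq_eq h3) ?_); ring1) | (refine absurd hd (notMem_of_eq (nSp9_n3_q hm hq hn hq_eq h3) ?_); ring1) | (refine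 absurd hd (notMem_of_eq (nSp9_n3_mq hm hq hn hq_eq h3) ?_); ring1) | (refine absurd hd (notMem_of_eq (nSp9_p15_1 hm hq hn hq_eq h3) ?_); ring1) | (refine absurd hd (notMem_of_eq (nSp9_p15_m hm hq hn hq_eq h3) ?_); ring1) | (refine absurd hd (notMem_of_eq (nSp9_p15_q hm hq hn hq_eq h3) ?_); ring1) | (refine absurd hd (notMem_of_eq (nSp9_p15_mq hm hq hn hq_eq h3) ?_); ring1) | (refine absurd hd (notMem_of_eq (nSp9_n15_1 hm hq hn hq_eq h3) ?_); ring1) | (refine absurd hd (notMem_of_eq (nSp9_n15_m hm hq hn hq_eq h3) ?_); ring1) | (refine absurd hd (notMem_of_eq (nSp9_n15_q hm hq hn hq_eq h3) ?_); ring1) | (refine absurd hd (notMem_of_eq (nSp9_n15_mq hm hq hn hq_eq h3) ?_); ring1)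

/-- **`S(34q, 225mq) ⊆ {1, mq, −q, −m, −3, −3mq, 3q, 3m}` when `m ≡ ±2 (mod 5)`**: the classes with `5 ∥ d` die
modulo `25`, those `≡ 3 (mod 4)` modulo `16`. [cite: SilvermanAEC2009, Prop. X.4.9 and Example X.4.10] -/
theorem selmerGroup'_subset_five (hm : m.Prime) (hq : q.Prime) (hn : 60 ∣ n) (hq_eq : (q : ℤ) = m + 64 * n ^ 2) (hm8 : m % 8 = 3) (h5 : m % 5 = 2 ∨ m % 5 = 3) :
    twoIsogenySelmerGroup (34 * q) (225 * m * q) ⊆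
      ({1, (m : ℤ) * q, -(q : ℤ), -(m : ℤ), -3, -(3 * ((m : ℤ) * q)), 3 * (q : ℤ), 3 * (m : ℤ)} : Finset ℤ) := by
  intro d hd
  obtain ⟨hsq, hdvd, -⟩ := (mem_twoIsogenySelmerGroup_iff (a := 34 * (q : ℤ)) (b'_ne_zero hm hq)).mp hd
  have h1 : d ∣ 15 * m * q :=
    (hsq.dvd_pow_iff_dvd (by norm_num : (2 : ℕ) ≠ 0)).mp (dvd_trans hdvd ⟨(m : ℤ) * q, by ring⟩)
  have h2 : d.natAbs ∣ 3 * (5 * (m * q)) := by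
    have h := Int.natAbs_dvd_natAbs.mpr h1
    have e : (3 * (5 * (m * q)) : ℕ) = (15 * m * q : ℤ).natAbs := by
      zify; rw [abs_of_nonneg (by positivity)]; ring
    rwa [e]
  obtain ⟨y, z, hy, hz, hyz⟩ := Nat.dvd_mul.mp h2
  obtain ⟨y₁, z₁, hy₁, hz₁, rfl⟩ := Nat.dvd_mul.mp hz
  obtain ⟨y₂, z₂, hy₂, hz₂, rfl⟩ := Nat.dvd_mul.mp hz₁
  rw [Nat.dvd_prime Nat.prime_three] at hy
  rw [Nat.dvd_prime Nat.prime_five] at hy₁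
  rw [Nat.dvd_prime hm] at hy₂
  rw [Nat.dvd_prime hq] at hz₂
  rcases Int.natAbs_eq d with hd' | hd' <;> rw [← hyz] at hd' <;>
    rcases hy with rfl | rfl <;> rcases hy₁ with rfl | rfl <;> rcases hy₂ with rfl | rfl <;> rcases hz₂ with rfl | rfl <;>
    push_cast at hd' <;> subst hd'
  all_goals first
    | (simp; done)
    | (refine absurd hd (notMem_of_eq (nSp16_p1_m hm hq hn hq_eq hm8) ?_); ring1) | (refine absurd hd (notMem_of_eq (nSp16_p1_q hm hq hn hq_eq hm8) ?_); ring1) | (refine absurd hd (notMem_of_eq (nSp16_p5_m hm hq hn hq_eq hm8) ?_); ring1) | (refine absurd hd (notMem_of_eq (nSp16_p5_q hm hq hn hq_eq hm8) ?_); ring1) | (refine absurd hd (notMem_of_eq (nSp16_n3_m hm hq hn hq_eq hm8) ?_); ring1) | (refine absurd hd (notMem_of_eq (nSp16_n3_q hm hq hn hq_eq hm8) ?_); ring1) | (refine absurd hd (notMem_of_eq (nSp16_n1_1 hm hq hn hq_eq hm8) ?_); ring1) | (refine absurd hd (notMem_of_eq (nSp16_n1_mq hm hq hn hq_eq hm8)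 ?_); ring1) | (refine absurd hd (notMem_of_eq (nSp16_n5_1 hm hq hn hq_eq hm8) ?_); ring1) | (refine absurd hd (notMem_of_eq (nSp16_n5_mq hm hq hn hq_eq hm8) ?_); ring1) | (refine absurd hd (notMem_of_eq (nSp16_p3_1 hm hq hn hq_eq hm8) ?_); ring1) | (refine absurd hd (notMem_of_eq (nSp16_p3_mq hm hq hn hq_eq hm8) ?_); ring1) | (refine absurd hd (notMem_of_eq (nSp25_p5_1 hm hq hn hq_eq h5) ?_); ring1) | (refine absurd hd (notMem_of_eq (nSp25_p5_m hm hq hn hq_eq h5) ?_); ring1) | (refine absurd hd (notMem_of_eq (nSp25_p5_q hm hq hn hq_eq h5) ?_); ring1) | (refine absurd hd (notMem_of_eq (nSp25_p5_mq hm hq hn hq_eq h5) ?_); ring1) | (refine absurd hd (notMem_of_eq (nSp25_n5_1 hm hq hn hq_eq h5) ?_); ring1) | (refine absurd hd (notMem_of_eq (nSp25_n5_m hm hq hn hq_eq h5) ?_); ring1) | (refine absurd hd (notMem_of_eq (nSp25_n5_q hm hq hn hq_eq h5) ?_); ring1) | (refine absurd hd (notMem_of_eq (nSp25_n5_mq hm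 hq hn hq_eq h5) ?_); ring1) | (refine absurd hd (notMem_of_eq (nSp25_p15_1 hm hq hn hq_eq h5) ?_); ring1) | (refine absurd hd (notMem_of_eq (nSp25_p15_m hm hq hn hq_eq h5) ?_); ring1) | (refine absurd hd (notMem_of_eq (nSp25_p15_q hm hq hn hq_eq h5) ?_); ring1) | (refine absurd hd (notMem_of_eq (nSp25_p15_mq hm hq hn hq_eq h5) ?_); ring1) | (refine absurd hd (notMem_of_eq (nSp25_n15_1 hm hq hn hq_eq h5) ?_); ring1) | (refine absurd hd (notMem_of_eq (nSp25_n15_m hm hq hn hq_eq h5) ?_); ring1) | (refine absurd hd (notMem_of_eq (nSp25_n15_q hm hq hn hq_eq h5) ?_); ring1) | (refine absurd hd (notMem_of_eq (nSp25_n15_mq hm hq hn hq_eq h5) ?_); ring1)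

/-! ### 4. `dim₂ S ≤ 2`, `dim₂ S' ≤ 3` on the odd half, `rank ≤ 3`; sharpness when `rank = 3` -/

/-- **`dim₂ S^{(φ̂)}(E'/ℚ) ≤ 2`** for every admissible member. [cite: SilvermanAEC2009, Prop. X.4.9] -/
theorem twoIsogenySelmerRank_le_two (hm : m.Prime) (hq : q.Prime) (hr : r.Prime) (hn : 60 ∣ n) (hq_eq : (q : ℤ) = m + 64 * n ^ 2) (hr_eq : (r : ℤ) = m + 289 * n ^ 2) (hm8 : m % 8 = 3) :
    twoIsogenySelmerRank (-17 * q) (16 * q * r) ≤ 2 := by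
  apply le_of_two_pow_le
  rw [two_pow_twoIsogenySelmerRank_eq_card (family81517_hab hm hq hr hq_eq hr_eq)]
  exact (Finset.card_le_card (selmerGroup_subset (m := m) hq hr hn hq_eq hr_eq hm8)).trans Finset.card_le_four

/-- **`dim₂ S^{(φ)}(E/ℚ) ≤ 3`** when `m ≡ 2 (mod 3)` or `m ≡ ±2 (mod 5)` — in particular on the whole odd half.
[cite: SilvermanAEC2009, Prop. X.4.9] -/
theorem twoIsogenySelmerRank'_le_three (hm : m.Prime) (hq : q.Prime) (hr : r.Prime) (hn : 60 ∣ n) (hq_eq : (q : ℤ) = m + 64 * n ^ 2) (hr_eq : (r : ℤ) = m + 289 * n ^ 2) (hm8 : m % 8 = 3)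
    (hodd : m % 3 = 2 ∨ (m % 5 = 2 ∨ m % 5 = 3)) :
    twoIsogenySelmerRank' (-17 * q) (16 * q * r) ≤ 3 := by
  apply le_of_two_pow_le
  rw [two_pow_twoIsogenySelmerRank'_eq_card (family81517_hab hm hq hr hq_eq hr_eq), twoIsogenySelmerGroup'_eq,
    show (-2 * (-17 * q) : ℤ) = 34 * q by ring, family81517_disc hq_eq hr_eq]
  rcases hodd with h3 | h5
  · exact (Finset.card_le_card (selmerGroup'_subset_three hm hq hn hq_eq hm8 h3)).trans card_le_eight
  · exact (Finset.card_le_card (selmerGroup'_subset_five hm hq hn hq_eq hm8 h5)).trans card_le_eight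

/-- **`rank E_{−17q,16qr}(ℚ) ≤ 3` on the odd half** (`dim₂ S + dim₂ S' ≤ 5`, `rank + 2 ≤ dim₂ S + dim₂ S'`).
[cite: SilvermanTate2015, §3.6 (the rank inequality); SilvermanAEC2009, Prop. X.4.9] -/
theorem mordellWeilRank_le_three (hm : m.Prime) (hq : q.Prime) (hr : r.Prime) (hn : 60 ∣ n) (hq_eq : (q : ℤ) = m + 64 * n ^ 2) (hr_eq : (r : ℤ) = m + 289 * n ^ 2) (hm8 : m % 8 = 3)
    (hodd : m % 3 = 2 ∨ (m % 5 = 2 ∨ m % 5 = 3)) :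
    (⟨0, ((-17 * q : ℤ) : ℚ), 0, ((16 * q * r : ℤ) : ℚ), 0⟩ : WeierstrassCurve ℚ).mordellWeilRank ≤ 3 := by
  have h := twoIsogeny_mordellWeilRank_add_two_le_holds (-17 * (q : ℤ)) (16 * q * r) (family81517_hab hm hq hr hq_eq hr_eq)
  have h1 := twoIsogenySelmerRank_le_two hm hq hr hn hq_eq hr_eq hm8
  have h2 := twoIsogenySelmerRank'_le_three hm hq hr hn hq_eq hr_eq hm8 hodd
  omega

/-- **`rank ∈ {2, 3}` on the odd half** (`2 ≤ rank` is the tree's planted-point kernel `two_le_mordellWeilRank_family81517`). -/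
theorem mordellWeilRank_eq_two_or_three (hm : m.Prime) (hq : q.Prime) (hr : r.Prime) (hn : 60 ∣ n) (hq_eq : (q : ℤ) = m + 64 * n ^ 2) (hr_eq : (r : ℤ) = m + 289 * n ^ 2) (hm8 : m % 8 = 3) (hn0 : n ≠ 0)
    (hodd : m % 3 = 2 ∨ (m % 5 = 2 ∨ m % 5 = 3)) :
    (⟨0, ((-17 * q : ℤ) : ℚ), 0, ((16 * q * r : ℤ) : ℚ), 0⟩ : WeierstrassCurve ℚ).mordellWeilRank = 2 ∨ (⟨0, ((-17 * q : ℤ) : ℚ), 0, ((16 * q * r : ℤ) : ℚ), 0⟩ : WeierstrassCurve ℚ).mordellWeilRank = 3 := by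
  have h1 := mordellWeilRank_le_three hm hq hr hn hq_eq hr_eq hm8 hodd
  have h2 := two_le_mordellWeilRank_family81517 hm hq hr hn0 hq_eq hr_eq
  omega

/-- **Sharpness at rank `3`**: if `rank = 3` then `Ш(E/ℚ)[2] = 0`, `corank Ш[2^∞] = 0`, `corank Sel_{2^∞}(E) = 3` and
`(dim₂ S, dim₂ S') = (2, 3)`. [cite: SilvermanAEC2009, Prop. X.4.7 with Thm. X.4.2(a)] -/
theorem sharp_of_mordellWeilRank_eq_three (hm : m.Prime) (hq : q.Prime) (hr : r.Prime) (hn : 60 ∣ n) (hq_eq : (q : ℤ) = m + 64 * n ^ 2) (hr_eq : (r : ℤ) = m + 289 * n ^ 2) (hm8 : m % 8 = 3)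
    (hodd : m % 3 = 2 ∨ (m % 5 = 2 ∨ m % 5 = 3)) (h3 : (⟨0, ((-17 * q : ℤ) : ℚ), 0, ((16 * q * r : ℤ) : ℚ), 0⟩ : WeierstrassCurve ℚ).mordellWeilRank = 3) :
    (∀ c ∈ (⟨0, ((-17 * q : ℤ) : ℚ), 0, ((16 * q * r : ℤ) : ℚ), 0⟩ : WeierstrassCurve ℚ).sha, 2 • c = 0 → c = 0) ∧ (⟨0, ((-17 * q : ℤ) : ℚ), 0, ((16 * q * r : ℤ) : ℚ), 0⟩ : WeierstrassCurve ℚ).shaCorank 2 = 0 ∧ (⟨0, ((-17 * q : ℤ) : ℚ), 0, ((16 * q * r : ℤ) : ℚ), 0⟩ : WeierstrassCurve ℚ).selmerCorank 2 = 3 ∧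
      twoIsogenySelmerRank (-17 * q) (16 * q * r) = 2 ∧ twoIsogenySelmerRank' (-17 * q) (16 * q * r) = 3 := by
  have hab := family81517_hab hm hq hr hq_eq hr_eq
  haveI := isElliptic_halfModel hab
  haveI := isElliptic_mk_of_ne_zero (F := ℚ) hab
  haveI : Fact (Nat.Prime 2) := ⟨Nat.prime_two⟩
  have h1 := twoIsogenySelmerRank_le_two hm hq hr hn hq_eq hr_eq hm8
  have h2 := twoIsogenySelmerRank'_le_three hm hq hr hn hq_eq hr_eq hm8 hodd
  have hle : twoIsogenySelmerRank (-17 * (q : ℤ)) (16 * q * r) + twoIsogenySelmerRank' (-17 * (q : ℤ)) (16 * q * r) ≤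
      (⟨0, ((-17 * q : ℤ) : ℚ), 0, ((16 * q * r : ℤ) : ℚ), 0⟩ : WeierstrassCurve ℚ).mordellWeilRank + 2 := by
    omega
  have hsha := forall_mem_sha_two_smul_eq_zero_of_selmerRank_add_le (a := -17 * (q : ℤ)) (b := 16 * q * r) hab hle
  have hshaCorank : (⟨0, ((-17 * q : ℤ) : ℚ), 0, ((16 * q * r : ℤ) : ℚ), 0⟩ : WeierstrassCurve ℚ).shaCorank 2 = 0 := shaCorank_eq_zero_of_forall _ 2 hsha
  obtain ⟨-, -, hsum⟩ := natCard_sha_inf_range_eq_one_of_selmerRank_add_le (a := -17 * (q : ℤ)) (b := 16 * q * r) hab hle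
  refine ⟨hsha, hshaCorank, ?_, by omega, by omega⟩
  rw [WeierstrassCurve.selmerCorank_eq_mordellWeilRank_add_holds, h3, hshaCorank]

/-! ### 5. The door family `Family81517.curve j n`: parameters, `rank ≤ 3`, and `rank = 3 ⇒ corank Sel_{2^∞} = 3` -/

/-- Natural-number parameters `(m, q, r)` of an admissible member and the congruence bookkeeping. [this file] -/
theorem params_of_admissible {j n : ℤ} (hadm : Family81517.AdmissibleF j n) :
    ∃ m q r : ℕ, m.Prime ∧ q.Prime ∧ r.Prime ∧ (m : ℤ) = 8 * j + 3 ∧ (q : ℤ) = m + 64 * n ^ 2 ∧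
      (r : ℤ) = m + 289 * n ^ 2 ∧ m % 8 = 3 ∧ Family81517.qOf j n = q ∧ Family81517.rOf j n = r := by
  obtain ⟨hj, hmP, -, -, hqP, hrP⟩ := hadm
  simp only [Family81517.mOf, Family81517.qOf, Family81517.rOf] at hmP hqP hrP ⊢
  have hn2 : 0 ≤ n ^ 2 := sq_nonneg n
  have em : (((8 * j + 3).natAbs : ℕ) : ℤ) = 8 * j + 3 := Int.natAbs_of_nonneg (by omega)
  have eq : (((8 * j + 3 + 64 * n ^ 2).natAbs : ℕ) : ℤ) = 8 * j + 3 + 64 * n ^ 2 := Int.natAbs_of_nonneg (by omega)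
  have er : (((8 * j + 3 + 289 * n ^ 2).natAbs : ℕ) : ℤ) = 8 * j + 3 + 289 * n ^ 2 := Int.natAbs_of_nonneg (by omega)
  refine ⟨(8 * j + 3).natAbs, (8 * j + 3 + 64 * n ^ 2).natAbs, (8 * j + 3 + 289 * n ^ 2).natAbs,
    Int.prime_iff_natAbs_prime.mp hmP, Int.prime_iff_natAbs_prime.mp hqP, Int.prime_iff_natAbs_prime.mp hrP, em,
    by rw [eq, em], by rw [er, em], by omega, eq.symm, er.symm⟩

/-- The congruence form of `OddSign` in terms of `m`: `m ≡ 2 (mod 3)` or `m ≡ ±2 (mod 5)` (`q ≡ m (mod 15)`,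
`3, 5 ∤ m`, and exactly one of `q ≡ 1 (3)`, `q ≡ ±1 (5)` holds). [this file] -/
theorem mod_of_oddSign {j n : ℤ} {m q : ℕ} (hm : m.Prime) (hm_eq : (m : ℤ) = 8 * j + 3) (hj : 1 ≤ j)
    (hn : 60 ∣ n) (hq_eq : (q : ℤ) = m + 64 * n ^ 2) (hqOf : Family81517.qOf j n = q)
    (hodd : Family81517.OddSign j n) : m % 3 = 2 ∨ (m % 5 = 2 ∨ m % 5 = 3) := by
  unfold Family81517.OddSign at hodd
  rw [hqOf] at hodd
  obtain ⟨k, rfl⟩ := hn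
  have hc : (q : ℤ) = m + 15 * (15360 * k ^ 2) := by rw [hq_eq]; ring
  generalize (15360 * k ^ 2 : ℤ) = c at hc
  clear hq_eq
  have hm3 : m % 3 ≠ 0 := by
    intro h
    have h3 : 3 ∣ m := Nat.dvd_of_mod_eq_zero h
    rcases (Nat.dvd_prime hm).mp h3 with h | h <;> omega
  have hm5 : m % 5 ≠ 0 := by
    intro h
    have h5 : 5 ∣ m := Nat.dvd_of_mod_eq_zero h
    rcases (Nat.dvd_prime hm).mp h5 with h | h <;> omega
  rcases (by omega : m % 3 = 1 ∨ m % 3 = 2) with hm31 | hm32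
  · right
    have hq31 : (q : ℤ) % 3 = 1 := by omega
    have h := hodd.mp hq31
    clear hodd
    omega
  · exact Or.inl hm32

/-- The door's member is the `a₁ = 1` model `⟨1, A, 0, qr, 0⟩`, `4A = −17q − 1`. [this file] -/
theorem curve_eq_model {j n : ℤ} {q r : ℕ} (hqOf : Family81517.qOf j n = q) (hrOf : Family81517.rOf j n = r) :
    Family81517.curve j n = ⟨1, (((-(34 * (j + 8 * n ^ 2)) - 13 : ℤ)) : ℚ), 0, (((q : ℤ) * r : ℤ) : ℚ), 0⟩ := by
  simp only [Family81517.curve, hqOf, hrOf]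

/-- **`rank (curve j n)(ℚ) ≤ 3` for EVERY odd admissible member**, UNCONDITIONALLY; with the planted kernel, `rank ∈ {2, 3}`.
[cite: SilvermanTate2015, §3.6; SilvermanAEC2009, Prop. X.4.9, Example X.4.10] -/
theorem curve_mordellWeilRank_le_three (j n : ℤ) (hadm : Family81517.AdmissibleF j n) (hodd : Family81517.OddSign j n) :
    (Family81517.curve j n).mordellWeilRank ≤ 3 ∧ 2 ≤ (Family81517.curve j n).mordellWeilRank := by
  have hj : 1 ≤ j := hadm.1
  have hn0 : n ≠ 0 := hadm.2.2.1
  have hn : 60 ∣ n := hadm.2.2.2.1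
  obtain ⟨m, q, r, hm, hq, hr, hm_eq, hq_eq, hr_eq, hm8, hqOf, hrOf⟩ := params_of_admissible hadm
  have hodd' := mod_of_oddSign hm hm_eq hj hn hq_eq hqOf hodd
  have hA : 4 * ((-(34 * (j + 8 * n ^ 2)) - 13 : ℤ)) = -17 * q - 1 := by rw [hq_eq, hm_eq]; ring
  set C : VariableChange ℚ := ⟨Units.mk0 (2 : ℚ) two_ne_zero, 0, 1, 0⟩ with hC
  set E : WeierstrassCurve ℚ := ⟨0, ((-17 * q : ℤ) : ℚ), 0, ((16 * q * r : ℤ) : ℚ), 0⟩ with hE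
  have hinv : (C • E).mordellWeilRank = E.mordellWeilRank := mordellWeilRank_variableChange_holds E C
  rw [hC, hE, variableChange_family81517 (r := r) hA] at hinv
  rw [curve_eq_model hqOf hrOf, hinv]
  exact ⟨mordellWeilRank_le_three hm hq hr hn hq_eq hr_eq hm8 hodd',
    two_le_mordellWeilRank_family81517 hm hq hr hn0 hq_eq hr_eq⟩

/-- **Door `T-r3₂` (ii), algebraic conjunct, reduced to the Mordell–Weil rank**: for every odd admissible member,
`rank (curve j n) = 3 ⇒ corank_{ℤ₂} Sel_{2^∞}(curve j n) = 3` (and `Ш[2] = 0` on the `E_{−17q,16qr}` model), UNCONDITIONALLY.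
[cite: SilvermanAEC2009, Prop. X.4.7 with Thm. X.4.2(a)] -/
theorem curve_selmerCorank_eq_three_of_rank_eq_three (j n : ℤ) (hadm : Family81517.AdmissibleF j n)
    (hodd : Family81517.OddSign j n) (h3 : (Family81517.curve j n).mordellWeilRank = 3) :
    (Family81517.curve j n).selmerCorank 2 = 3 := by
  have hj : 1 ≤ j := hadm.1
  have hn : 60 ∣ n := hadm.2.2.2.1
  obtain ⟨m, q, r, hm, hq, hr, hm_eq, hq_eq, hr_eq, hm8, hqOf, hrOf⟩ := params_of_admissible hadm
  have hodd' := mod_of_oddSign hm hm_eq hj hn hq_eq hqOf hodd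
  have hA : 4 * ((-(34 * (j + 8 * n ^ 2)) - 13 : ℤ)) = -17 * q - 1 := by rw [hq_eq, hm_eq]; ring
  have hV := variableChange_family81517 (r := r) hA
  haveI hEll := isElliptic_family81517 hm hq hr hq_eq hr_eq
  haveI : (Family81517.curve j n).IsElliptic := by
    rw [curve_eq_model hqOf hrOf, ← hV]; infer_instance
  have hinv : ((⟨Units.mk0 (2 : ℚ) two_ne_zero, 0, 1, 0⟩ : VariableChange ℚ) •
      (⟨0, ((-17 * q : ℤ) : ℚ), 0, ((16 * q * r : ℤ) : ℚ), 0⟩ : WeierstrassCurve ℚ)).mordellWeilRank =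
      (⟨0, ((-17 * q : ℤ) : ℚ), 0, ((16 * q * r : ℤ) : ℚ), 0⟩ : WeierstrassCurve ℚ).mordellWeilRank :=
    mordellWeilRank_variableChange_holds _ _
  rw [hV, ← curve_eq_model hqOf hrOf, h3] at hinv
  have hsharp := sharp_of_mordellWeilRank_eq_three hm hq hr hn hq_eq hr_eq hm8 hodd' hinv.symm
  have hV' : (⟨Units.mk0 (2 : ℚ) two_ne_zero, 0, 1, 0⟩ : VariableChange ℚ) •
      (⟨0, ((-17 * q : ℤ) : ℚ), 0, ((16 * q * r : ℤ) : ℚ), 0⟩ : WeierstrassCurve ℚ) = Family81517.curve j n := by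
    rw [hV, curve_eq_model hqOf hrOf]
  rw [← selmerCorank_eq_of_variableChange 2 hV']
  exact hsharp.2.2.1

/-- **HEADLINE (whole odd family).** For every `(j, n)` with `AdmissibleF j n ∧ OddSign j n`:
`2 ≤ rank (curve j n) ≤ 3`, and `rank = 3 → corank_{ℤ₂} Sel_{2^∞}(curve j n) = 3` — the door's algebraic conjunct is
exactly the statement `rank = 3 ∨ (rank = 2 ∧ corank Ш[2^∞] = 1)` member by member. BSD is not proved; no S0 motion.
[this file] -/
theorem oddFamily_rank_le_three_and_selmerCorank_of_rank :
    ∀ j n : ℤ, Family81517.AdmissibleF j n → Family81517.OddSign j n →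
      2 ≤ (Family81517.curve j n).mordellWeilRank ∧ (Family81517.curve j n).mordellWeilRank ≤ 3 ∧
        ((Family81517.curve j n).mordellWeilRank = 3 → (Family81517.curve j n).selmerCorank 2 = 3) :=
  fun j n hadm hodd =>
    ⟨(curve_mordellWeilRank_le_three j n hadm hodd).2, (curve_mordellWeilRank_le_three j n hadm hodd).1,
      curve_selmerCorank_eq_three_of_rank_eq_three j n hadm hodd⟩



end Summit.BirchSwinnertonDyer.BirchSwinnertonDyer.Theorems.Family81517IsogenySelmerBound
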